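import Summits.CriticalPhenomena.PercolationContinuityZ3.Theses.PercNearOneGluing
import Literature.Probability.Percolation.PercolationEvents
import HarnessLib.Audit
import Literature.Probability.LatticeModels.ProdBernoulliIndependence
import Literature.Probability.LatticeModels.ProdBernoulliCoupling
import Literature.Probability.LatticeModels.ProdBernoulliAtomExpansion

/-! TTRL-lite variant V2441 of stmt-CriticalPhenomena-4574

(`stub_shorteningStep` of line `kn_shortening_induction`, move `small_case+small_case`:
`A.card ≤ 2` and `n ≤ 4`).  Write `μ = prodBernoulli (w[s(v,x) ↦ 1])` (the glued weights) and
`P = prodBernoulli w`.  Under `μ` the pair `s(v,x)` is a.s. open, under `P` it is a.s. closed.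
The cases `b = v`, `a₀ = x`, `b = x` are as in the sibling variant V2374 (`n ≤ 3`); the case
`b = a₀` is settled for every `n` by a union bound (the minimiser hypothesis forces
`P(a ↔ a₀) = 1`, hence `μ(a ↔ a₀) = 1`, for every relay `a ∈ A`).  Otherwise `v, x, a₀, b` are
four distinct vertices, so `n = 4` and they exhaust `Fin n`; every relay is then one of
`x, a₀, b`.  If `x ∉ A` then `A ⊆ {a₀, b}` and Harris' inequality under `μ` concludes.  If `x ∈ A`
the minimiser hypothesis `P(a₀ ↔ b) ≤ P(x ↔ b)` is converted, by splitting both events along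
the other one and reading off the differences on the four-vertex graph, into the cylinder
inequality `P(D₁) ≤ P(D₂)` (`D₁ = {a₀b open, xa₀ closed, xb closed}`,
`D₂ = {xb open, xa₀ closed, a₀b closed}`); the cylinders do not involve `s(v,x)`, so the same
inequality holds under `μ`, and multiplying by the independent cylinder
`N = {va₀ closed, vb closed}` gives `μ(D₁ ∩ N) ≤ μ(D₂ ∩ N)`, which is exactly
`μ(a₀ ↔ b, v ↮ b) ≤ μ(v ↔ b, a₀ ↮ b)`, i.e. `μ(a₀ ↔ b) ≤ μ(v ↔ b)`; since `x ∈ A` is glued to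
`v` this is the claim.  The hypothesis `A.card ≤ 2` and the induction hypothesis are not used.
No new definitions, no named facts. -/

namespace Summit.CriticalPhenomena.PercolationContinuityZ3.Theorems

open MeasureTheory Set Literature.Probability.LatticeModels Literature.Probability.Percolation
open scoped Classical BigOperators

/-- TTRL-lite variant V2441 of `stub_shorteningStep` (stmt-CriticalPhenomena-4574, Kozma–Nitzan
Conjecture 6 with induction hypothesis): the shortening step on at most four vertices (with at
most two relays).  With `μ = prodBernoulli (w[s(v,x) ↦ 1])`: the cases `b ∈ {v, x}` and `a₀ = x`
follow from `μ(x ↔ z) ≤ μ(v ↔ z)`; the case `b = a₀` from `μ(a ↔ a₀) = 1` for all `a ∈ A`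
(minimiser hypothesis, monotonicity in the weights, union bound); otherwise `{v, x, a₀, b}` is
all of `Fin n`, and either `A ⊆ {a₀, b}` (Harris' inequality) or `x ∈ A`, where the minimiser
hypothesis `P_w(a₀ ↔ b) ≤ P_w(x ↔ b)` yields the cylinder comparison
`μ(a₀b open; xa₀, xb, va₀, vb closed) ≤ μ(xb open; xa₀, a₀b, va₀, vb closed)`, i.e.
`μ(a₀ ↔ b) ≤ μ(v ↔ b)`. -/
theorem stub_shorteningStep_var2441 : ∀ (n : ℕ) (w : Sym2 (Fin n) → unitInterval) (A : Finset (Fin n)) (b v x a₀ : Fin n), A.card ≤ 2 → n ≤ 4 → v ∉ A → v ≠ x → w s(v, x) = 0 → a₀ ∈ A → (∀ a ∈ A, (prodBernoulli w).real (openConn a₀ b) ≤ (prodBernoulli w).real (openConn a b)) → (∀ w' : Sym2 (Fin n) → unitInterval, (∀ e, w e = 0 → w' e = 0) → ∀ (A' : Finset (Fin n)) (o' b' : Fin n) (t : ℝ), (∀ a ∈ A', t ≤ (prodBernoulli w').real (openConn a b')) → (prodBernoulli w').real (⋃ a ∈ A', openConn o' a) * t ≤ (prodBernoulli w').real (openConn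 o' b')) → (prodBernoulli (Function.update w s(v, x) 1)).real (⋃ a ∈ A, openConn v a) * (prodBernoulli (Function.update w s(v, x) 1)).real (openConn a₀ b) ≤ (prodBernoulli (Function.update w s(v, x) 1)).real (openConn v b) := by
  intro n w A b v x a₀ _hcard hn hvA hvx hw0 ha₀ hmin _hIH
  set q : Sym2 (Fin n) → unitInterval := Function.update w s(v, x) 1 with hq
  have hq1 : q s(v, x) = 1 := by rw [hq, Function.update_self]
  have hqw : ∀ e, e ≠ s(v, x) → q e = w e := fun e he => by rw [hq, Function.update_of_ne he]
  have hle : w ≤ q := by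
    intro e
    by_cases he : e = s(v, x)
    · rw [he, hq1]; exact unitInterval.le_one _
    · rw [hqw e he]
  -- every event on the finite configuration space is measurable
  have hmeas : ∀ S : Set (BondConfig (Fin n)), MeasurableSet S := fun S =>
    (Set.toFinite S).measurableSet
  -- basic bounds on the two factors
  have hY0 : 0 ≤ (prodBernoulli q).real (⋃ a ∈ A, openConn v a) := measureReal_nonneg
  have hY1 : (prodBernoulli q).real (⋃ a ∈ A, openConn v a) ≤ 1 := measureReal_le_one
  have hZ0 : 0 ≤ (prodBernoulli q).real (openConn a₀ b) := measureReal_nonneg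
  have hZ1 : (prodBernoulli q).real (openConn a₀ b) ≤ 1 := measureReal_le_one
  -- the product is at most each factor, and at most `1`
  have hLY : (prodBernoulli q).real (⋃ a ∈ A, openConn v a) * (prodBernoulli q).real (openConn a₀ b) ≤
      (prodBernoulli q).real (⋃ a ∈ A, openConn v a) := mul_le_of_le_one_right hY0 hZ1
  have hLZ : (prodBernoulli q).real (⋃ a ∈ A, openConn v a) * (prodBernoulli q).real (openConn a₀ b) ≤
      (prodBernoulli q).real (openConn a₀ b) := mul_le_of_le_one_left hZ0 hY1
  have hL1 : (prodBernoulli q).real (⋃ a ∈ A, openConn v a) * (prodBernoulli q).real (openConn a₀ b) ≤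
      1 := hLY.trans hY1
  -- under `μ` the glued pair is closed with probability `0`; under `P` it is open with probability `0`
  have hclosed : (prodBernoulli q).real {ω : BondConfig (Fin n) | s(v, x) ∉ ω} = 0 := by
    rw [prodBernoulli_real_setOf_notMem, hq1]
    simp
  have hopen : (prodBernoulli w).real {ω : BondConfig (Fin n) | s(v, x) ∈ ω} = 0 := by
    rw [prodBernoulli_real_setOf_mem, hw0]
    simp
  -- transfer: if `E ∩ {s(v,x) open} ⊆ F` then `μ E ≤ μ F`
  have htransfer : ∀ E F : Set (BondConfig (Fin n)), (∀ ω ∈ E, s(v, x) ∈ ω → ω ∈ F) →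
      (prodBernoulli q).real E ≤ (prodBernoulli q).real F := by
    intro E F hEF
    have hsub : E ⊆ F ∪ {ω : BondConfig (Fin n) | s(v, x) ∉ ω} := by
      intro ω hω
      by_cases h : s(v, x) ∈ ω
      · exact Or.inl (hEF ω hω h)
      · exact Or.inr h
    calc (prodBernoulli q).real E
        ≤ (prodBernoulli q).real (F ∪ {ω : BondConfig (Fin n) | s(v, x) ∉ ω}) := measureReal_mono hsub
      _ ≤ (prodBernoulli q).real F +
            (prodBernoulli q).real {ω : BondConfig (Fin n) | s(v, x) ∉ ω} := measureReal_union_le _ _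
      _ = (prodBernoulli q).real F := by rw [hclosed, add_zero]
  -- transfer under `P`: if `E ∩ {s(v,x) closed} ⊆ F` then `P E ≤ P F`
  have htransferw : ∀ E F : Set (BondConfig (Fin n)), (∀ ω ∈ E, s(v, x) ∉ ω → ω ∈ F) →
      (prodBernoulli w).real E ≤ (prodBernoulli w).real F := by
    intro E F hEF
    have hsub : E ⊆ F ∪ {ω : BondConfig (Fin n) | s(v, x) ∈ ω} := by
      intro ω hω
      by_cases h : s(v, x) ∈ ω
      · exact Or.inr h
      · exact Or.inl (hEF ω hω h)
    calc (prodBernoulli w).real E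
        ≤ (prodBernoulli w).real (F ∪ {ω : BondConfig (Fin n) | s(v, x) ∈ ω}) := measureReal_mono hsub
      _ ≤ (prodBernoulli w).real F +
            (prodBernoulli w).real {ω : BondConfig (Fin n) | s(v, x) ∈ ω} := measureReal_union_le _ _
      _ = (prodBernoulli w).real F := by rw [hopen, add_zero]
  -- F1: `μ(x ↔ z) ≤ μ(v ↔ z)`
  have hF1 : ∀ z : Fin n, (prodBernoulli q).real (openConn x z) ≤
      (prodBernoulli q).real (openConn v z) := by
    intro z
    refine htransfer _ _ fun ω hω hvxω => ?_
    have hadj : (openGraph ω).Adj v x := (openGraph_adj ω v x).2 ⟨hvxω, hvx⟩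
    exact hadj.reachable.trans hω
  -- `{z ↔ z}` is the sure event
  have hrefl : ∀ (p : Sym2 (Fin n) → unitInterval) (z : Fin n),
      (prodBernoulli p).real (openConn z z) = 1 := by
    intro p z
    have : (openConn z z : Set (BondConfig (Fin n))) = Set.univ := by
      ext ω; exact ⟨fun _ => trivial, fun _ => SimpleGraph.Reachable.refl z⟩
    rw [this]; exact probReal_univ
  -- an isolated vertex reaches nobody else
  have hisol : ∀ (ω : BondConfig (Fin n)) (y z : Fin n), y ≠ z →
      (∀ u, ¬ (openGraph ω).Adj y u) → ¬ (openGraph ω).Reachable y z := by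
    intro ω y z hyz hno h
    obtain ⟨p⟩ := h
    cases p with
    | nil => exact hyz rfl
    | cons hadj _ => exact hno _ hadj
  -- case `b = v`
  by_cases hbv : b = v
  · subst hbv
    rw [hrefl]; exact hL1
  -- case `a₀ = x`
  by_cases ha₀x : a₀ = x
  · subst ha₀x
    exact hLZ.trans (hF1 b)
  have ha₀v : a₀ ≠ v := fun h => hvA (h ▸ ha₀)
  -- case `b = x`
  by_cases hbx : b = x
  · subst hbx
    have h1 : 1 ≤ (prodBernoulli q).real (openConn v b) := by
      have := hF1 b
      rwa [hrefl] at this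
    exact hL1.trans h1
  -- case `b = a₀`: every relay `a` has `P(a ↔ a₀) = 1`, hence `μ(a ↔ a₀) = 1` (union bound)
  by_cases hba : b = a₀
  · subst hba
    rw [hrefl, mul_one]
    have hnull : ∀ a ∈ A, (prodBernoulli q).real (openConn a b)ᶜ = 0 := by
      intro a ha
      have hm := hmin a ha
      rw [hrefl] at hm
      have hmono := prodBernoulli_real_mono_of_isUpperSet hle (isUpperSet_openConn a b) (hmeas _)
      rw [probReal_compl_eq_one_sub (hmeas _)]
      linarith [(measureReal_le_one : (prodBernoulli q).real (openConn a b) ≤ 1)]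
    have hdiff : (prodBernoulli q).real ((⋃ a ∈ A, openConn v a) \ openConn v b) = 0 := by
      have hsub : (⋃ a ∈ A, openConn v a) \ openConn v b ⊆
          ⋃ a ∈ A, (openConn a b : Set (BondConfig (Fin n)))ᶜ := by
        rintro ω ⟨hU, hvb0⟩
        simp only [mem_iUnion, exists_prop] at hU ⊢
        obtain ⟨a, ha, hva1⟩ := hU
        exact ⟨a, ha, fun hab1 => hvb0 (SimpleGraph.Reachable.trans hva1 hab1)⟩
      refine le_antisymm ?_ measureReal_nonneg
      calc (prodBernoulli q).real ((⋃ a ∈ A, openConn v a) \ openConn v b)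
          ≤ (prodBernoulli q).real (⋃ a ∈ A, (openConn a b : Set (BondConfig (Fin n)))ᶜ) :=
            measureReal_mono hsub (measure_ne_top _ _)
        _ ≤ ∑ a ∈ A, (prodBernoulli q).real (openConn a b : Set (BondConfig (Fin n)))ᶜ :=
            measureReal_biUnion_finset_le A _
        _ = 0 := Finset.sum_eq_zero hnull
    have hsplit := measureReal_inter_add_sdiff (μ := prodBernoulli q) (s := ⋃ a ∈ A, openConn v a)
      (hmeas (openConn v b)) (measure_ne_top _ _)
    have hint : (prodBernoulli q).real ((⋃ a ∈ A, openConn v a) ∩ openConn v b) ≤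
        (prodBernoulli q).real (openConn v b) := measureReal_mono Set.inter_subset_right
    linarith
  -- otherwise `v, x, a₀, b` are four distinct vertices: `n = 4` and they exhaust `Fin n`
  have hxv : x ≠ v := fun h => hvx h.symm
  have hva : v ≠ a₀ := fun h => ha₀v h.symm
  have hvb : v ≠ b := fun h => hbv h.symm
  have hxa : x ≠ a₀ := fun h => ha₀x h.symm
  have hxb : x ≠ b := fun h => hbx h.symm
  have hab : a₀ ≠ b := fun h => hba h.symm
  have h2 : ({a₀, b} : Finset (Fin n)).card = 2 := Finset.card_pair hab
  have h3 : x ∉ ({a₀, b} : Finset (Fin n)) := by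
    simp only [Finset.mem_insert, Finset.mem_singleton, not_or]
    exact ⟨hxa, hxb⟩
  have h4 : v ∉ ({x, a₀, b} : Finset (Fin n)) := by
    simp only [Finset.mem_insert, Finset.mem_singleton, not_or]
    exact ⟨hvx, hva, hvb⟩
  have hS4 : ({v, x, a₀, b} : Finset (Fin n)).card = 4 := by
    rw [Finset.card_insert_of_notMem h4, Finset.card_insert_of_notMem h3, h2]
  have hcardle : ({v, x, a₀, b} : Finset (Fin n)).card ≤ n := by
    calc ({v, x, a₀, b} : Finset (Fin n)).card ≤ Fintype.card (Fin n) := Finset.card_le_univ _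
      _ = n := Fintype.card_fin n
  have hn4 : n = 4 := by rw [hS4] at hcardle; omega
  have hSU : ({v, x, a₀, b} : Finset (Fin n)) = Finset.univ :=
    Finset.eq_univ_of_card _ (by rw [hS4, Fintype.card_fin, hn4])
  have huniv : ∀ u : Fin n, v = u ∨ x = u ∨ a₀ = u ∨ b = u := by
    intro u
    have hu : u ∈ ({v, x, a₀, b} : Finset (Fin n)) := by rw [hSU]; exact Finset.mem_univ u
    simp only [Finset.mem_insert, Finset.mem_singleton] at hu
    rcases hu with h | h | h | h
    exacts [Or.inl h.symm, Or.inr (Or.inl h.symm), Or.inr (Or.inr (Or.inl h.symm)),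
      Or.inr (Or.inr (Or.inr h.symm))]
  by_cases hxA : x ∈ A
  swap
  · -- `x ∉ A`: every relay is `a₀` or `b`; Harris' inequality under `μ`
    have hAsub : ∀ a ∈ A, a₀ = a ∨ b = a := by
      intro a ha
      rcases huniv a with h | h | h | h
      · exact absurd (h ▸ ha) hvA
      · exact absurd (h ▸ ha) hxA
      · exact Or.inl h
      · exact Or.inr h
    have hU : IsUpperSet (⋃ a ∈ A, (openConn v a : Set (BondConfig (Fin n)))) :=
      isUpperSet_iUnion₂ fun a _ => isUpperSet_openConn v a
    have hH := prodBernoulli_harris q hU (isUpperSet_openConn a₀ b) (hmeas _) (hmeas _)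
    have hsub : (⋃ a ∈ A, (openConn v a : Set (BondConfig (Fin n)))) ∩ openConn a₀ b ⊆
        openConn v b := by
      rintro ω ⟨hU', hab1⟩
      simp only [mem_iUnion, exists_prop] at hU'
      obtain ⟨a, ha, hva1⟩ := hU'
      rcases hAsub a ha with rfl | rfl
      · exact SimpleGraph.Reachable.trans hva1 hab1
      · exact hva1
    exact hH.trans (measureReal_mono hsub)
  -- `x ∈ A`: it suffices to show `μ(a₀ ↔ b) ≤ μ(v ↔ b)`
  refine hLZ.trans ?_
  have hminx : (prodBernoulli w).real (openConn a₀ b) ≤ (prodBernoulli w).real (openConn x b) :=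
    hmin x hxA
  -- the six edges are pairwise distinct (the twelve instances used below)
  have hE : s(a₀, b) ≠ s(x, a₀) ∧ s(a₀, b) ≠ s(x, b) ∧ s(x, a₀) ≠ s(x, b) ∧
      s(a₀, b) ≠ s(v, a₀) ∧ s(a₀, b) ≠ s(v, b) ∧ s(x, a₀) ≠ s(v, a₀) ∧ s(x, a₀) ≠ s(v, b) ∧
      s(x, b) ≠ s(v, a₀) ∧ s(x, b) ≠ s(v, b) ∧
      s(a₀, b) ≠ s(v, x) ∧ s(x, a₀) ≠ s(v, x) ∧ s(x, b) ≠ s(v, x) := by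
    refine ⟨?_, ?_, ?_, ?_, ?_, ?_, ?_, ?_, ?_, ?_, ?_, ?_⟩ <;>
      simp [hxv, ha₀v, hbv, hxa, ha₀x, hxb, hbx, hab, hba]
  obtain ⟨e_ab_xa, e_ab_xb, e_xa_xb, e_ab_va, e_ab_vb, e_xa_va, e_xa_vb, e_xb_va, e_xb_vb,
    e_ab_vx, e_xa_vx, e_xb_vx⟩ := hE
  -- the cylinders
  set FD : Finset (Sym2 (Fin n)) := {s(a₀, b), s(x, a₀), s(x, b)} with hFD
  set FN : Finset (Sym2 (Fin n)) := {s(v, a₀), s(v, b)} with hFN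
  set D1 : Set (BondConfig (Fin n)) := {ω | ∀ i ∈ FD, (i ∈ ω ↔ i = s(a₀, b))} with hD1
  set D2 : Set (BondConfig (Fin n)) := {ω | ∀ i ∈ FD, (i ∈ ω ↔ i = s(x, b))} with hD2
  set N : Set (BondConfig (Fin n)) := {ω | ∀ i ∈ FN, (i ∈ ω ↔ False)} with hN
  have hD1_iff : ∀ ω : BondConfig (Fin n), ω ∈ D1 ↔ (s(a₀, b) ∈ ω ∧ s(x, a₀) ∉ ω ∧ s(x, b) ∉ ω) := by
    intro ω
    simp only [hD1, mem_setOf_eq, hFD, Finset.mem_insert, Finset.mem_singleton, forall_eq_or_imp,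
      forall_eq]
    simp [e_ab_xa.symm, e_ab_xb.symm]
  have hD2_iff : ∀ ω : BondConfig (Fin n), ω ∈ D2 ↔ (s(a₀, b) ∉ ω ∧ s(x, a₀) ∉ ω ∧ s(x, b) ∈ ω) := by
    intro ω
    simp only [hD2, mem_setOf_eq, hFD, Finset.mem_insert, Finset.mem_singleton, forall_eq_or_imp,
      forall_eq]
    simp [e_ab_xb, e_xa_xb]
  have hN_iff : ∀ ω : BondConfig (Fin n), ω ∈ N ↔ (s(v, a₀) ∉ ω ∧ s(v, b) ∉ ω) := by
    intro ω
    simp only [hN, mem_setOf_eq, hFN, Finset.mem_insert, Finset.mem_singleton, forall_eq_or_imp,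
      forall_eq, iff_false]
  -- events of this shape are determined by their index set
  have hdet : ∀ (F : Finset (Sym2 (Fin n))) (P : Sym2 (Fin n) → Prop),
      DeterminedBy {ω : BondConfig (Fin n) | ∀ i ∈ F, (i ∈ ω ↔ P i)} (↑F : Set (Sym2 (Fin n))) := by
    intro F P
    rw [determinedBy_iff]
    intro ω ω' h
    simp only [mem_setOf_eq]
    refine forall₂_congr fun i hi => ?_
    have hi' := Set.ext_iff.1 h i
    simp only [mem_inter_iff, Finset.mem_coe, hi, and_true] at hi'
    rw [hi']
  have hdisj : Disjoint FD FN := by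
    rw [hFD, hFN, Finset.disjoint_insert_left, Finset.disjoint_insert_left,
      Finset.disjoint_singleton_left]
    simp only [Finset.mem_insert, Finset.mem_singleton, not_or]
    exact ⟨⟨e_ab_va, e_ab_vb⟩, ⟨e_xa_va, e_xa_vb⟩, ⟨e_xb_va, e_xb_vb⟩⟩
  have hFDne : ∀ i ∈ FD, i ≠ s(v, x) := by
    intro i hi
    simp only [hFD, Finset.mem_insert, Finset.mem_singleton] at hi
    rcases hi with rfl | rfl | rfl
    exacts [e_ab_vx, e_xa_vx, e_xb_vx]
  -- the cylinders `D1`, `D2` have the same probability under `μ` and under `P`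
  have hD1eq : (prodBernoulli q).real D1 = (prodBernoulli w).real D1 := by
    rw [hD1, prodBernoulli_real_setOf_forall_iff q FD, prodBernoulli_real_setOf_forall_iff w FD]
    exact Finset.prod_congr rfl fun i hi => by rw [hqw i (hFDne i hi)]
  have hD2eq : (prodBernoulli q).real D2 = (prodBernoulli w).real D2 := by
    rw [hD2, prodBernoulli_real_setOf_forall_iff q FD, prodBernoulli_real_setOf_forall_iff w FD]
    exact Finset.prod_congr rfl fun i hi => by rw [hqw i (hFDne i hi)]
  -- independence of `Dᵢ` and `N` under `μ`
  have hC1 : (prodBernoulli q).real (D1 ∩ N) = (prodBernoulli q).real D1 * (prodBernoulli q).real N :=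
    prodBernoulli_real_inter_of_determinedBy_disjoint q hdisj (hdet FD _) (hdet FN _) (hmeas _) (hmeas _)
  have hC2 : (prodBernoulli q).real (D2 ∩ N) = (prodBernoulli q).real D2 * (prodBernoulli q).real N :=
    prodBernoulli_real_inter_of_determinedBy_disjoint q hdisj (hdet FD _) (hdet FN _) (hmeas _) (hmeas _)
  -- (H1) the minimiser hypothesis gives `P(D1) ≤ P(D2)`
  have hI1 : (prodBernoulli w).real D1 ≤ (prodBernoulli w).real (openConn a₀ b \ openConn x b) := by
    refine htransferw _ _ fun ω hω hvx0 => ?_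
    obtain ⟨hab1, hxa0, hxb0⟩ := (hD1_iff ω).1 hω
    refine ⟨((openGraph_adj ω a₀ b).2 ⟨hab1, hab⟩).reachable, ?_⟩
    refine hisol ω x b hxb fun u hu => ?_
    rw [openGraph_adj] at hu
    obtain ⟨hmem, hxu⟩ := hu
    rcases huniv u with rfl | rfl | rfl | rfl
    · rw [Sym2.eq_swap] at hmem; exact hvx0 hmem
    · exact hxu rfl
    · exact hxa0 hmem
    · exact hxb0 hmem
  have hI2 : (prodBernoulli w).real (openConn x b \ openConn a₀ b) ≤ (prodBernoulli w).real D2 := by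
    refine htransferw _ _ fun ω hω hvx0 => ?_
    obtain ⟨hxb1, hab0⟩ := hω
    have hab0' : s(a₀, b) ∉ ω := fun h => hab0 ((openGraph_adj ω a₀ b).2 ⟨h, hab⟩).reachable
    have hxa0 : s(x, a₀) ∉ ω := fun h =>
      hab0 (((openGraph_adj ω x a₀).2 ⟨h, hxa⟩).reachable.symm.trans hxb1)
    refine (hD2_iff ω).2 ⟨hab0', hxa0, ?_⟩
    by_contra hxb0
    refine hisol ω x b hxb (fun u hu => ?_) hxb1
    rw [openGraph_adj] at hu
    obtain ⟨hmem, hxu⟩ := hu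
    rcases huniv u with rfl | rfl | rfl | rfl
    · rw [Sym2.eq_swap] at hmem; exact hvx0 hmem
    · exact hxu rfl
    · exact hxa0 hmem
    · exact hxb0 hmem
  have hsa := measureReal_inter_add_sdiff (μ := prodBernoulli w) (s := openConn a₀ b)
    (hmeas (openConn x b))
  have hsx := measureReal_inter_add_sdiff (μ := prodBernoulli w) (s := openConn x b)
    (hmeas (openConn a₀ b))
  rw [Set.inter_comm] at hsx
  have H1 : (prodBernoulli w).real D1 ≤ (prodBernoulli w).real D2 := by linarith
  -- (H2) transport to `μ` and multiply by the independent cylinder `N`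
  have H2 : (prodBernoulli q).real (D1 ∩ N) ≤ (prodBernoulli q).real (D2 ∩ N) := by
    rw [hC1, hC2, hD1eq, hD2eq]
    exact mul_le_mul_of_nonneg_right H1 measureReal_nonneg
  -- reading off the differences under `μ`
  have hI3 : (prodBernoulli q).real (openConn a₀ b \ openConn v b) ≤ (prodBernoulli q).real (D1 ∩ N) := by
    refine htransfer _ _ fun ω hω hvx1 => ?_
    obtain ⟨hab1, hvb0⟩ := hω
    have hvxadj : (openGraph ω).Adj v x := (openGraph_adj ω v x).2 ⟨hvx1, hvx⟩
    have hvb0' : s(v, b) ∉ ω := fun h => hvb0 ((openGraph_adj ω v b).2 ⟨h, hvb⟩).reachable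
    have hxb0 : s(x, b) ∉ ω := fun h =>
      hvb0 (hvxadj.reachable.trans ((openGraph_adj ω x b).2 ⟨h, hxb⟩).reachable)
    have hva0 : s(v, a₀) ∉ ω := fun h =>
      hvb0 (((openGraph_adj ω v a₀).2 ⟨h, hva⟩).reachable.trans hab1)
    have hxa0 : s(x, a₀) ∉ ω := fun h =>
      hvb0 (hvxadj.reachable.trans (((openGraph_adj ω x a₀).2 ⟨h, hxa⟩).reachable.trans hab1))
    have hab1' : s(a₀, b) ∈ ω := by
      by_contra hab0
      refine hisol ω b a₀ hba (fun u hu => ?_) (SimpleGraph.Reachable.symm hab1)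
      rw [openGraph_adj] at hu
      obtain ⟨hmem, hbu⟩ := hu
      rcases huniv u with rfl | rfl | rfl | rfl
      · rw [Sym2.eq_swap] at hmem; exact hvb0' hmem
      · rw [Sym2.eq_swap] at hmem; exact hxb0 hmem
      · rw [Sym2.eq_swap] at hmem; exact hab0 hmem
      · exact hbu rfl
    exact ⟨(hD1_iff ω).2 ⟨hab1', hxa0, hxb0⟩, (hN_iff ω).2 ⟨hva0, hvb0'⟩⟩
  have hI4 : (prodBernoulli q).real (D2 ∩ N) ≤ (prodBernoulli q).real (openConn v b \ openConn a₀ b) := by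
    refine htransfer _ _ fun ω hω hvx1 => ?_
    obtain ⟨hD, hNω⟩ := hω
    obtain ⟨hab0, hxa0, hxb1⟩ := (hD2_iff ω).1 hD
    obtain ⟨hva0, hvb0⟩ := (hN_iff ω).1 hNω
    have hvxadj : (openGraph ω).Adj v x := (openGraph_adj ω v x).2 ⟨hvx1, hvx⟩
    refine ⟨hvxadj.reachable.trans ((openGraph_adj ω x b).2 ⟨hxb1, hxb⟩).reachable, ?_⟩
    refine hisol ω a₀ b hab fun u hu => ?_
    rw [openGraph_adj] at hu
    obtain ⟨hmem, hau⟩ := hu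
    rcases huniv u with rfl | rfl | rfl | rfl
    · rw [Sym2.eq_swap] at hmem; exact hva0 hmem
    · rw [Sym2.eq_swap] at hmem; exact hxa0 hmem
    · exact hau rfl
    · exact hab0 hmem
  have hs1 := measureReal_inter_add_sdiff (μ := prodBernoulli q) (s := openConn a₀ b)
    (hmeas (openConn v b))
  have hs2 := measureReal_inter_add_sdiff (μ := prodBernoulli q) (s := openConn v b)
    (hmeas (openConn a₀ b))
  rw [Set.inter_comm] at hs2
  linarith

end Summit.CriticalPhenomena.PercolationContinuityZ3.Theorems
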